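import Summits.AtomisticToContinuum.Crystallization.Theorems.ChartedPlanarOrderTubeChannelsBoxP

/-!
# ChartedPlanarOrder — the census TAG 182 R1′ literals (tracking-free cover of the record T box) typed against slot 7c‴P (decomp-a2c lens-3 g27)

Critic row 545 of cell `decomp-a2c` (2026-08-31): census g17's job j344651 (engine `r1p.py`, outward interval arithmetic) certified — on a cell
`⊇ Pinned 0.966 0.976`, covered by 88 sub-boxes (86 certified, 2 provably empty), localisation by exclusion only — the two LIVE T-branch Hessian
leaves of slot 7c‴P of the cut of record, with the literals

* adjacent block `HessCertAdjBox (boxT s₁ s₂ ∧ PhiT) (221/100) (1348/100) (329/100)` (worst window `(2.21350, 13.48730, 3.28793)`);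
* span blocks `s = 2..5`: `HessCertFarBox (boxT s₁ s₂ ∧ PhiT) alT₁ alN₁ ga₁ 6`, `(α_T, α_N, γ)(s) = (58/10⁴, 467/10³, 58/10⁴)`,
  `(8/10⁴, 444/10⁴, 8/10⁴)`, `(5/10⁴, 83/10⁴, 5/10⁴)`, `(3/10⁴, 24/10⁴, 3/10⁴)`.

(The C182 adjacent literals `(2.4071, 13.2864, 2.5136)` of `…TubeChannelsBoxP.tubeConvexRefP_of_hessCertsT_C182` are certified only on the
exactly-centred ball, not on the semantic tube the hypothesis quantifies over — critic row 545 (2); this module is their honest replacement.)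

Contents.  §1 the literal-free T-box twins of the C182 endpoints, generic in the leaf constants `lT lN μT μN`, the weights `θ θ_f` and the
closing slack `lam` (the two S leaves are VACUOUS on a pinned cell with `97/150·s₂² < s₁²`: `…TubeChannelsBoxP.adjacentChannelRefSBox_extinct`,
`farChannelBelowRefSBox_extinct`); §2 the R1′ tables `alT₁ alN₁ ga₁` and far moduli `muT₁ = (67, 10, 6, 4)/10⁴`, `muN₁ = (5085, 502, 119, 46)/10⁴`
(`B₁T = 554/10⁴`, `B₁N = 27912/10⁴`); §3 the closing with `θ = 17/50`, `θ_f = 7/50`, `lT = 109/100`, `lN = 19/5`, `lam = 1/4`: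

  `tubeConvexRefP_of_hessCertsT_R1P : 97/150·s₂² < s₁² → 0 ≤ s₁ → HessCertAdjBox (boxT s₁ s₂ ∧ PhiT) (221/100) (1348/100) (329/100) →
     HessCertFarBox (boxT s₁ s₂ ∧ PhiT) alT₁ alN₁ ga₁ 6 → TubeConvexRefP (17/16) (1/40) s₁ s₂ 1 0`

— the type of the binder `hT` of the cut of record (cone XL, `…OverbindingBudgetGrossMargin.rdef_fortieth_of_recordK_gross_ref`) — and the instance
at the record box `[0.966, 0.976]`.  Arithmetic (`norm_num`): `109/100 ≤ 221/100 − 17/50·329/100 = 1.0914`, `19/5 ≤ 1348/100 − 329/100·50/17 =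
3.8035…`, `μ_T(s) ≥ α_T(s)·(1 + 7/50)`, `μ_N(s) ≥ α_N(s) + γ(s)·50/7` (`s = 2`: `0.5085 ≥ 0.50843`), `1/4 + 554/10⁴ + 7/10 ≤ 109/100`,
`1/4 + 27912/10⁴ + 7/10 ≤ 19/5`.
-/

noncomputable section

namespace Summit.AtomisticToContinuum.Crystallization.Theorems.ChartedPlanarOrderChannelCertR1P

open Summit.AtomisticToContinuum.Crystallization.Theorems.ChartedPlanarOrderRigidityDoor (E3)
open Summit.AtomisticToContinuum.Crystallization.Theorems.OverbindingBudgetEnergyTubeBox (TubeConvexRefP TubeUniquenessRefP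
  tubeUniquenessRefP_of_tubeConvexRefP)
open Summit.AtomisticToContinuum.Crystallization.Theorems.ChartedPlanarOrderChannelJacobian (PhiT)
open Summit.AtomisticToContinuum.Crystallization.Theorems.ChartedPlanarOrderTubeChannelsBox (AdjacentChannelRefTBox FarChannelBelowRefTBox
  HessCertAdjBox HessCertFarBox adjacentChannelRefTBox_mono farChannelBelowRefTBox_mono adjacentChannelRefTBox_of_hess farChannelBelowRefTBox_of_hess
  tubeConvexRefBox_record_of_branch_certs₆)
open Summit.AtomisticToContinuum.Crystallization.Theorems.ChartedPlanarOrderTubeChannelsBoxP (boxT boxP_one_zero_iff tubeConvexRefP_iff_box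
  adjacentChannelRefSBox_extinct farChannelBelowRefSBox_extinct)

/-! ## §1 Literal-free T-box endpoints (S leaves vacuous) -/

/-- ★★ T-ONLY LEAF-LEVEL CLOSING, generic constants: on a T box with `97/150·s₂² < s₁²`, two box-restricted T leaves plus the closing arithmetic
`lam + B₁ + 7/10 ≤ l` give `TubeConvexRefP (17/16) (1/40) s₁ s₂ 1 0`; the S side is instantiated vacuously (`l′ = 13/4`, `μ′ = 0`, `lam′ = 1`). -/
theorem tubeConvexRefP_of_leafCertsT {s₁ s₂ lT lN lam B₁T B₁N : ℝ} {μT μN : ℕ → ℝ} (hs : 97 / 150 * s₂ ^ 2 < s₁ ^ 2) (hs₁ : 0 ≤ s₁)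
    (hAT : AdjacentChannelRefTBox (17 / 16) (1 / 40) (boxT s₁ s₂) lT lN) (hBT : FarChannelBelowRefTBox (17 / 16) (1 / 40) (boxT s₁ s₂) μT μN 6)
    (hμT : ∀ s, 0 ≤ μT s) (hμN : ∀ s, 0 ≤ μN s) (h₁T : ∑ s ∈ Finset.Ico 2 6, ((s : ℕ) : ℝ) ^ 2 * μT s ≤ B₁T)
    (h₁N : ∑ s ∈ Finset.Ico 2 6, ((s : ℕ) : ℝ) ^ 2 * μN s ≤ B₁N) (hlam : 0 < lam) (hlamT : lam + (B₁T + 7 / 10) ≤ lT)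
    (hlamN : lam + (B₁N + 7 / 10) ≤ lN) : TubeConvexRefP (17 / 16) (1 / 40) s₁ s₂ 1 0 :=
  tubeConvexRefP_iff_box.2
    (tubeConvexRefBox_record_of_branch_certs₆ (adjacentChannelRefTBox_mono (fun _ _ _ h => boxP_one_zero_iff.1 h) hAT)
      (farChannelBelowRefTBox_mono (fun _ _ _ h => boxP_one_zero_iff.1 h) hBT) hμT hμN h₁T h₁N hlam hlamT hlamN
      (adjacentChannelRefSBox_extinct (lT := 13 / 4) (lN := 13 / 4) hs hs₁)
      (farChannelBelowRefSBox_extinct (μT := fun _ => 0) (μN := fun _ => 0) hs hs₁) (fun _ => le_rfl) (fun _ => le_rfl)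
      (B₁T' := 0) (B₁N' := 0) (by simp) (by simp) (lam' := 1) one_pos (by norm_num) (by norm_num))

/-- ★★ its Hessian dictionary, generic constants: adjacent certificate `(αT, αN, γ)` with weight `θ`, span certificates `(αTf, αNf, γf)(s)` with
weights `θf s`, moduli `lT ≤ αT − θγ`, `lN ≤ αN − γ/θ`, `μT s ≥ αTf s + θf s·γf s`, `μN s ≥ αNf s + γf s/θf s`, and the closing slack. -/
theorem tubeConvexRefP_of_hessCertsT {s₁ s₂ αT αN γ θ lT lN lam B₁T B₁N : ℝ} {αTf αNf γf θf μT μN : ℕ → ℝ}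
    (hs : 97 / 150 * s₂ ^ 2 < s₁ ^ 2) (hs₁ : 0 ≤ s₁) (hA : HessCertAdjBox (fun a b w' => boxT s₁ s₂ a b w' ∧ PhiT a b) αT αN γ) (hθ : 0 < θ)
    (hγ : 0 ≤ γ) (hlT : lT ≤ αT - θ * γ) (hlN : lN ≤ αN - γ / θ) (hF : HessCertFarBox (fun a b w' => boxT s₁ s₂ a b w' ∧ PhiT a b) αTf αNf γf 6)
    (hθf : ∀ s, 0 < θf s) (hγf : ∀ s, 0 ≤ γf s) (hμTf : ∀ s, αTf s + θf s * γf s ≤ μT s) (hμNf : ∀ s, αNf s + γf s / θf s ≤ μN s)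
    (hμT : ∀ s, 0 ≤ μT s) (hμN : ∀ s, 0 ≤ μN s) (h₁T : ∑ s ∈ Finset.Ico 2 6, ((s : ℕ) : ℝ) ^ 2 * μT s ≤ B₁T)
    (h₁N : ∑ s ∈ Finset.Ico 2 6, ((s : ℕ) : ℝ) ^ 2 * μN s ≤ B₁N) (hlam : 0 < lam) (hlamT : lam + (B₁T + 7 / 10) ≤ lT)
    (hlamN : lam + (B₁N + 7 / 10) ≤ lN) : TubeConvexRefP (17 / 16) (1 / 40) s₁ s₂ 1 0 :=
  tubeConvexRefP_of_leafCertsT hs hs₁ (adjacentChannelRefTBox_of_hess hA hθ hγ hlT hlN) (farChannelBelowRefTBox_of_hess hF hθf hγf hμTf hμNf)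
    hμT hμN h₁T h₁N hlam hlamT hlamN

/-! ## §2 The R1′ tables (critic row 545 (1); census j344651) -/

/-- R1′ span tangential softening `α_T(2..5) = (58, 8, 5, 3)/10⁴`. -/
def alT₁ : ℕ → ℝ := fun s => if s = 2 then 58 / 10000 else if s = 3 then 8 / 10000 else if s = 4 then 5 / 10000 else if s = 5 then 3 / 10000 else 0

/-- R1′ span normal softening `α_N(2..5) = (4670, 444, 83, 24)/10⁴`. -/
def alN₁ : ℕ → ℝ := fun s => if s = 2 then 467 / 1000 else if s = 3 then 444 / 10000 else if s = 4 then 83 / 10000 else if s = 5 then 24 / 10000 else 0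

/-- R1′ span coupling `γ(2..5) = (58, 8, 5, 3)/10⁴`. -/
def ga₁ : ℕ → ℝ := fun s => if s = 2 then 58 / 10000 else if s = 3 then 8 / 10000 else if s = 4 then 5 / 10000 else if s = 5 then 3 / 10000 else 0

/-- far tangential moduli `μ_T(2..5) = (67, 10, 6, 4)/10⁴` (`≥ α_T(s)·(1 + 7/50)`). -/
def muT₁ : ℕ → ℝ := fun s => if s = 2 then 67 / 10000 else if s = 3 then 10 / 10000 else if s = 4 then 6 / 10000 else if s = 5 then 4 / 10000 else 0

/-- far normal moduli `μ_N(2..5) = (5085, 502, 119, 46)/10⁴` (`≥ α_N(s) + γ(s)·50/7`). -/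
def muN₁ : ℕ → ℝ :=
  fun s => if s = 2 then 5085 / 10000 else if s = 3 then 502 / 10000 else if s = 4 then 119 / 10000 else if s = 5 then 46 / 10000 else 0

/-- `0 ≤ muT₁ s`. [folklore] -/
theorem muT₁_nonneg (s : ℕ) : 0 ≤ muT₁ s := by unfold muT₁; split_ifs <;> norm_num

/-- `0 ≤ muN₁ s`. [folklore] -/
theorem muN₁_nonneg (s : ℕ) : 0 ≤ muN₁ s := by unfold muN₁; split_ifs <;> norm_num

/-- `B₁T = Σ_{s=2}^{5} s²·μ_T(s) = 554/10⁴`. -/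
theorem sum_muT₁ : ∑ s ∈ Finset.Ico 2 6, ((s : ℕ) : ℝ) ^ 2 * muT₁ s = 554 / 10000 := by
  rw [Finset.sum_Ico_eq_sum_range]; simp only [Finset.sum_range_succ, Finset.sum_range_zero, muT₁]; norm_num

/-- `B₁N = Σ_{s=2}^{5} s²·μ_N(s) = 27912/10⁴`. -/
theorem sum_muN₁ : ∑ s ∈ Finset.Ico 2 6, ((s : ℕ) : ℝ) ^ 2 * muN₁ s = 27912 / 10000 := by
  rw [Finset.sum_Ico_eq_sum_range]; simp only [Finset.sum_range_succ, Finset.sum_range_zero, muN₁]; norm_num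

/-! ## §3 The R1′ endpoints -/

/-- ★★★ LEAF LEVEL with the R1′ adjacent moduli `(lT, lN) = (109/100, 19/5)` and far moduli `muT₁ muN₁` (`lam = 1/4`). -/
theorem tubeConvexRefP_of_leafCertsT_R1P {s₁ s₂ : ℝ} (hs : 97 / 150 * s₂ ^ 2 < s₁ ^ 2) (hs₁ : 0 ≤ s₁)
    (hAT : AdjacentChannelRefTBox (17 / 16) (1 / 40) (boxT s₁ s₂) (109 / 100) (19 / 5))
    (hBT : FarChannelBelowRefTBox (17 / 16) (1 / 40) (boxT s₁ s₂) muT₁ muN₁ 6) : TubeConvexRefP (17 / 16) (1 / 40) s₁ s₂ 1 0 :=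
  tubeConvexRefP_of_leafCertsT hs hs₁ hAT hBT muT₁_nonneg muN₁_nonneg sum_muT₁.le sum_muN₁.le (lam := 1 / 4) (by norm_num) (by norm_num)
    (by norm_num)

/-- ★★★ THE R1′ ENDPOINT (critic row 545 (3)): the two census-certified T-branch Hessian leaves [CERT·M, TAG 182 R1′, j344651] give slot 7c‴P of the
cut of record, `TubeConvexRefP (17/16) (1/40) s₁ s₂ 1 0`, on every T box with `97/150·s₂² < s₁²`, `0 ≤ s₁` (weights `θ = 17/50`, `θ_f = 7/50`). -/
theorem tubeConvexRefP_of_hessCertsT_R1P {s₁ s₂ : ℝ} (hs : 97 / 150 * s₂ ^ 2 < s₁ ^ 2) (hs₁ : 0 ≤ s₁)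
    (hA : HessCertAdjBox (fun a b w' => boxT s₁ s₂ a b w' ∧ PhiT a b) (221 / 100) (1348 / 100) (329 / 100))
    (hF : HessCertFarBox (fun a b w' => boxT s₁ s₂ a b w' ∧ PhiT a b) alT₁ alN₁ ga₁ 6) : TubeConvexRefP (17 / 16) (1 / 40) s₁ s₂ 1 0 :=
  tubeConvexRefP_of_leafCertsT_R1P hs hs₁
    (adjacentChannelRefTBox_of_hess hA (θ := 17 / 50) (by norm_num) (by norm_num) (by norm_num) (by norm_num))
    (farChannelBelowRefTBox_of_hess hF (θ := fun _ => 7 / 50) (fun _ => by norm_num) (fun s => by unfold ga₁; split_ifs <;> norm_num)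
      (fun s => by unfold alT₁ ga₁ muT₁; split_ifs <;> norm_num) (fun s => by unfold alN₁ ga₁ muN₁; split_ifs <;> norm_num))

/-- ★★ the record T box `[0.966, 0.976]` (`97/150·0.976² < 0.966²`). -/
theorem tubeConvexRefP_record_of_hessCertsT_R1P
    (hA : HessCertAdjBox (fun a b w' => boxT (966 / 1000) (976 / 1000) a b w' ∧ PhiT a b) (221 / 100) (1348 / 100) (329 / 100))
    (hF : HessCertFarBox (fun a b w' => boxT (966 / 1000) (976 / 1000) a b w' ∧ PhiT a b) alT₁ alN₁ ga₁ 6) :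
    TubeConvexRefP (17 / 16) (1 / 40) (966 / 1000) (976 / 1000) 1 0 :=
  tubeConvexRefP_of_hessCertsT_R1P (by norm_num) (by norm_num) hA hF

/-- ★★ … and in the uniqueness currency (`tubeUniquenessRefP_of_tubeConvexRefP`). -/
theorem tubeUniquenessRefP_of_hessCertsT_R1P {s₁ s₂ : ℝ} (hs : 97 / 150 * s₂ ^ 2 < s₁ ^ 2) (hs₁ : 0 ≤ s₁)
    (hA : HessCertAdjBox (fun a b w' => boxT s₁ s₂ a b w' ∧ PhiT a b) (221 / 100) (1348 / 100) (329 / 100))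
    (hF : HessCertFarBox (fun a b w' => boxT s₁ s₂ a b w' ∧ PhiT a b) alT₁ alN₁ ga₁ 6) : TubeUniquenessRefP (17 / 16) (1 / 40) s₁ s₂ 1 0 :=
  tubeUniquenessRefP_of_tubeConvexRefP (tubeConvexRefP_of_hessCertsT_R1P hs hs₁ hA hF)

/-- cone XL's binder `hT : TubeConvexRefP (17/16) (1/40) s₁ s₂ 1 0` (`…OverbindingBudgetGrossMargin.rdef_fortieth_of_recordK_gross_ref`), re-derived
from the two R1′ leaves under cone XL's side condition `289·s₂² ≤ 388·s₁²` and `0 < s₁` (`289/388 > 97/150`). -/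
example {s₁ s₂ : ℝ} (hs : 289 * s₂ ^ 2 ≤ 388 * s₁ ^ 2) (hs₁ : 0 < s₁)
    (hA : HessCertAdjBox (fun a b w' => boxT s₁ s₂ a b w' ∧ PhiT a b) (221 / 100) (1348 / 100) (329 / 100))
    (hF : HessCertFarBox (fun a b w' => boxT s₁ s₂ a b w' ∧ PhiT a b) alT₁ alN₁ ga₁ 6) : TubeConvexRefP (17 / 16) (1 / 40) s₁ s₂ 1 0 :=
  tubeConvexRefP_of_hessCertsT_R1P (by nlinarith [sq_nonneg s₂, pow_pos hs₁ 2]) hs₁.le hA hF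

end Summit.AtomisticToContinuum.Crystallization.Theorems.ChartedPlanarOrderChannelCertR1P

end
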